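import Summits.Langlands.Langlands.Theorems.QuadraticWindowHostInducedRepAsaiPoleInduced
import Literature.NumberTheory.Automorphic.AsaiSignContinuation

/-!
# Asai poles of an automorphic induction — continuation form of the hypotheses — companion file A of
stub `stub_asaiPoleInduced` of line `one-transparent-pane`
(crux `Summit.Langlands.Langlands.Theses.QuadraticWindow.HostInducedRep`, item stmt-Langlands-10902)

LOG (landing worker, wave 3, 2026-08-16).  FACT-FREE (theorems only).  Contents:
* `hsign_of_continuation` — Mok's Asai-pole dichotomy in its CORRECTED continuation form (verbatim the
  hypothesis `h` of the accepted reduction `Mok2014_partialAsaiL_pole_dichotomy_of_continuation` of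
  `AsaiSignContinuation.lean`: Mok 2014 §2.5, Thm. 2.5.4 (a); Grbac–Shahidi 2015 Thm. 4.3 (2)) together
  with the currency hypothesis `H₃` of `stub_asaiPoleInduced_cond` (holomorphy of the raw partial Asai
  products of a.e.-unitary cuspidal data on `{1 < Re s}`) implies its hypothesis `H₁` (typed pole-sign
  existence + finite raw limit at the opposite sign) — the deprecated raw rendering
  `Mok2014_partialAsaiL_pole_dichotomy` is bypassed entirely;
* `stub_asaiPoleInduced_cont` — REGISTERED: the Asai pole transfer with hypotheses (Mok corrected
  statement [published], Grbac–Shahidi 2015 Thm. 4.3 at `s = 1` for partial Asai functions, continuation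
  form [published; verbatim the body of the named fact `GrbacShahidi2015_partialAsaiL_at_one` filed by
  companion file B `…AsaiPoleInducedFacts`], `H₃` [Ramanujan-strength currency hypothesis]) — i.e. the
  registered transfer statement closed modulo two published facts and the single currency hypothesis of
  `AsaiSignContinuation.lean`.
Landing p-ids of the chain so far: AsaiLocalInduced p115698 · AsaiTowerPlaces p115887 · AsaiLocalIdentity
p116404 · AsaiFibreProducts p116604 · AsaiLocalIdentityQ p116811 · AsaiGlobalFactorisation p116974 · AsaiPoleInduced
(`stub_asaiPoleInduced_cond`) p117138 (this file and companion B: see the lead's NOTES).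
-/

set_option linter.dupNamespace false -- project-wide option (lakefile weak.linter.dupNamespace); `Summit.Langlands.Langlands` is the mandated namespace

open scoped Classical Topology
open Literature.NumberTheory.Automorphic
open Summit.Langlands.Langlands.Theorems.HostInducedRep.Negative
open IsDedekindDomain NumberField Polynomial Filter

namespace Summit.Langlands.Langlands.Theorems.HostInducedRep.OneTransparentPane

/-! ### From Mok's corrected (continuation) statement to the typed hypothesis `H₁` -/

/-- **Mok's dichotomy, continuation form, plus holomorphy of the raw products on `{1 < Re s}`, gives
the typed hypothesis `H₁` of `stub_asaiPoleInduced_cond`**: for a conjugate self-dual cuspidal `π` the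
sign `η` of the corrected statement (hypothesis `h`, verbatim that of
`Mok2014_partialAsaiL_pole_dichotomy_of_continuation`) satisfies `π.HasAsaiPole c η` — on `{1 < Re s}`
the raw product `(s-1) L^S(s, π, As^η)` coincides with its continuation `G`, whose value `G(1) ≠ 0` is the
limit (`tendsto_nhdsWithin_one_lt_re_of_continuation`) — and `L^S(s, π, As^{-η}) → H(1)` is finite at
`1⁺`; the holomorphy hypothesis is needed only for a.e.-unitary data, which conjugate self-dual cuspidal
data are (`eventually_norm_prod_eq_one_of_isConjSelfDualAE`).  Fact-free.
[cite: Mok2014, §2.5 and Thm. 2.5.4 (a)] [cite: GrbacShahidi2015, Thm. 4.3 (2)] -/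
theorem hsign_of_continuation
    (h : ∀ (F E : Type) [Field F] [NumberField F] [Field E] [NumberField E] [Algebra F E]
        (c : E ≃ₐ[F] E), Module.finrank F E = 2 → c ≠ 1 →
        ∀ (N : ℕ) (hcpt : isCompact_glFiniteIntegralLevel N E)
          (π : CuspidalAutomorphicRepData N E hcpt), 0 < N → π.1.IsConjSelfDualAE c →
          ∃ η : ℤˣ, ∀ (S : Set (HeightOneSpectrum (𝓞 F))) (A : SatakeFamily E),
            π.1.IsAsaiDatum c S A →
              ∃ σ₀ : ℝ, 1 ≤ σ₀ ∧
                (∀ (θ : ℤˣ) (s : ℂ), σ₀ < s.re →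
                  Multipliable fun v : {v : HeightOneSpectrum (𝓞 F) // v ∉ S} =>
                    ((asaiLocalPolynomial c A θ (placeAbove E v.1)).eval
                      ((v.1.residueCard : ℂ) ^ (-s)))⁻¹) ∧
                (∃ G : ℂ → ℂ, DifferentiableOn ℂ G {s : ℂ | 1 / 2 < s.re} ∧
                  (∀ s : ℂ, σ₀ < s.re → G s = (s - 1) * partialAsaiL S c A η s) ∧ G 1 ≠ 0) ∧
                (∃ H : ℂ → ℂ, DifferentiableOn ℂ H {s : ℂ | 1 / 2 < s.re} ∧
                  (∀ s : ℂ, σ₀ < s.re → H s = partialAsaiL S c A (-η) s) ∧ H 1 ≠ 0))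
    (hhol : ∀ (F E : Type) [Field F] [NumberField F] [Field E] [NumberField E] [Algebra F E]
      (c : E ≃ₐ[F] E), Module.finrank F E = 2 → c ≠ 1 →
      ∀ (N : ℕ) (hcpt : isCompact_glFiniteIntegralLevel N E) (π : CuspidalAutomorphicRepData N E hcpt),
        0 < N →
        (∀ᶠ w : HeightOneSpectrum (𝓞 E) in cofinite, ∀ α : Multiset ℂ,
          π.1.HasSatakeParamAt w α → ‖α.prod‖ = 1) →
        ∀ (S : Set (HeightOneSpectrum (𝓞 F))) (A : SatakeFamily E) (θ : ℤˣ), π.1.IsAsaiDatum c S A →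
          DifferentiableOn ℂ (partialAsaiL S c A θ) {s : ℂ | 1 < s.re}) :
    ∀ (F E : Type) [Field F] [NumberField F] [Field E] [NumberField E] [Algebra F E]
      (c : E ≃ₐ[F] E), Module.finrank F E = 2 → c ≠ 1 →
      ∀ (N : ℕ) (hcpt : isCompact_glFiniteIntegralLevel N E) (π : CuspidalAutomorphicRepData N E hcpt),
        0 < N → π.1.IsConjSelfDualAE c →
        ∃ η : ℤˣ, π.1.HasAsaiPole c η ∧
          ∀ (S : Set (HeightOneSpectrum (𝓞 F))) (A : SatakeFamily E), π.1.IsAsaiDatum c S A →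
            ∃ r : ℂ, Tendsto (partialAsaiL S c A (-η)) (𝓝[{s : ℂ | 1 < s.re}] 1) (𝓝 r) := by
  intro F E _ _ _ _ _ c h2 hc N hcpt π hN hπ
  obtain ⟨η, hη⟩ := h F E c h2 hc N hcpt π hN hπ
  have hu := eventually_norm_prod_eq_one_of_isConjSelfDualAE hN π hπ
  refine ⟨η, fun S A hSA => ?_, fun S A hSA => ?_⟩
  · obtain ⟨σ₀, hσ₀, -, ⟨G, hG, hGL, hG1⟩, -⟩ := hη S A hSA
    exact ⟨G 1, hG1, tendsto_nhdsWithin_one_lt_re_of_continuation hσ₀ hG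
      ((differentiableOn_id.sub_const 1).mul (hhol F E c h2 hc N hcpt π hN hu S A η hSA)) hGL⟩
  · obtain ⟨σ₀, hσ₀, -, -, ⟨H, hH, hHL, -⟩⟩ := hη S A hSA
    exact ⟨H 1, tendsto_nhdsWithin_one_lt_re_of_continuation hσ₀ hH
      (hhol F E c h2 hc N hcpt π hN hu S A (-η) hSA) hHL⟩

/-! ### The registered continuation-form corollary -/

/-- **Stub `stub_asaiPoleInduced`, continuation form** (registered): the Asai pole transfer
`Q.HasAsaiPole cK ε ↔ P.HasAsaiPole s ε` in the tower of the stub, GRANTED (in this order) Mok's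
Asai-pole dichotomy in its CORRECTED continuation form (published: Mok 2014 §2.5, Thm. 2.5.4 (a), with
Grbac–Shahidi 2015 Thm. 4.3 (2); verbatim the hypothesis `h` of the accepted
`Mok2014_partialAsaiL_pole_dichotomy_of_continuation`), Grbac–Shahidi 2015 Thm. 4.3 at `s = 1` for
partial Asai functions of a.e.-unitary cuspidal data (published; the body of
`GrbacShahidi2015_partialAsaiL_at_one`), and the single currency hypothesis `H₃` of
`AsaiSignContinuation.lean` (holomorphy of the raw partial Asai products of a.e.-unitary cuspidal data on
`{1 < Re s}`, Ramanujan-strength for rank `≥ 3`).  Proof: `stub_asaiPoleInduced_cond` with `H₁` supplied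
by `hsign_of_continuation`. [cite: Mok2014, Thm. 2.5.4 (a)] [cite: GrbacShahidi2015, Thm. 4.3] -/
theorem stub_asaiPoleInduced_cont :
    (∀ (F E : Type) [Field F] [NumberField F] [Field E] [NumberField E] [Algebra F E]
        (c : E ≃ₐ[F] E), Module.finrank F E = 2 → c ≠ 1 →
        ∀ (N : ℕ) (hcpt : isCompact_glFiniteIntegralLevel N E)
          (π : CuspidalAutomorphicRepData N E hcpt), 0 < N → π.1.IsConjSelfDualAE c →
          ∃ η : ℤˣ, ∀ (S : Set (HeightOneSpectrum (𝓞 F))) (A : SatakeFamily E),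
            π.1.IsAsaiDatum c S A →
              ∃ σ₀ : ℝ, 1 ≤ σ₀ ∧
                (∀ (θ : ℤˣ) (s : ℂ), σ₀ < s.re →
                  Multipliable fun v : {v : HeightOneSpectrum (𝓞 F) // v ∉ S} =>
                    ((asaiLocalPolynomial c A θ (placeAbove E v.1)).eval
                      ((v.1.residueCard : ℂ) ^ (-s)))⁻¹) ∧
                (∃ G : ℂ → ℂ, DifferentiableOn ℂ G {s : ℂ | 1 / 2 < s.re} ∧
                  (∀ s : ℂ, σ₀ < s.re → G s = (s - 1) * partialAsaiL S c A η s) ∧ G 1 ≠ 0) ∧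
                (∃ H : ℂ → ℂ, DifferentiableOn ℂ H {s : ℂ | 1 / 2 < s.re} ∧
                  (∀ s : ℂ, σ₀ < s.re → H s = partialAsaiL S c A (-η) s) ∧ H 1 ≠ 0)) →
    (∀ (F E : Type) [Field F] [NumberField F] [Field E] [NumberField E] [Algebra F E] (c : E ≃ₐ[F] E),
      Module.finrank F E = 2 → c ≠ 1 →
      ∀ (N : ℕ) (hcpt : isCompact_glFiniteIntegralLevel N E) (π : CuspidalAutomorphicRepData N E hcpt),
        0 < N →
        (∀ᶠ w : HeightOneSpectrum (𝓞 E) in cofinite, ∀ α : Multiset ℂ,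
          π.1.HasSatakeParamAt w α → ‖α.prod‖ = 1) →
        ∀ (S : Set (HeightOneSpectrum (𝓞 F))) (A : SatakeFamily E) (η : ℤˣ), π.1.IsAsaiDatum c S A →
          ∃ σ₀ : ℝ, 1 ≤ σ₀ ∧
            (∀ s : ℂ, σ₀ < s.re →
              Multipliable fun v : {v : HeightOneSpectrum (𝓞 F) // v ∉ S} =>
                ((asaiLocalPolynomial c A η (placeAbove E v.1)).eval ((v.1.residueCard : ℂ) ^ (-s)))⁻¹) ∧
            ∃ (k : ℕ) (δ : ℝ) (G : ℂ → ℂ), k ≤ 1 ∧ 0 < δ ∧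
              DifferentiableOn ℂ G ({s : ℂ | 1 < s.re} ∪ Metric.ball 1 δ) ∧
              (∀ s : ℂ, σ₀ < s.re → G s = (s - 1) ^ k * partialAsaiL S c A η s) ∧ G 1 ≠ 0) →
    (∀ (F E : Type) [Field F] [NumberField F] [Field E] [NumberField E] [Algebra F E]
      (c : E ≃ₐ[F] E), Module.finrank F E = 2 → c ≠ 1 →
      ∀ (N : ℕ) (hcpt : isCompact_glFiniteIntegralLevel N E) (π : CuspidalAutomorphicRepData N E hcpt),
        0 < N →
        (∀ᶠ w : HeightOneSpectrum (𝓞 E) in cofinite, ∀ α : Multiset ℂ,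
          π.1.HasSatakeParamAt w α → ‖α.prod‖ = 1) →
        ∀ (S : Set (HeightOneSpectrum (𝓞 F))) (A : SatakeFamily E) (θ : ℤˣ), π.1.IsAsaiDatum c S A →
          DifferentiableOn ℂ (partialAsaiL S c A θ) {s : ℂ | 1 < s.re}) →
    ∀ (F₀ K F' L : Type) [Field F₀] [NumberField F₀] [Field K] [NumberField K]
      [Field F'] [NumberField F'] [Field L] [NumberField L]
      [Algebra F₀ K] [Algebra K L] [Algebra F' L] (cK : K ≃ₐ[F₀] K) (s : L ≃ₐ[F'] L),
      Module.finrank F₀ K = 2 → Module.finrank K L = 2 → Module.finrank F' L = 2 → cK ≠ 1 → s ≠ 1 →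
      (∀ x : K, s (algebraMap K L x) = algebraMap K L (cK x)) →
    ∀ (n : ℕ) (hL : isCompact_glFiniteIntegralLevel n L)
      (hK : isCompact_glFiniteIntegralLevel (2 * n) K)
      (P : CuspidalAutomorphicRepData n L hL) (Q : CuspidalAutomorphicRepData (2 * n) K hK),
      0 < n → IsAutomorphicInductionAlong P.1 Q.1 → P.1.IsConjSelfDualAE s → Q.1.IsConjSelfDualAE cK →
      ∀ ε : ℤˣ, Q.1.HasAsaiPole cK ε ↔ P.1.HasAsaiPole s ε :=
  fun h hGS hhol => stub_asaiPoleInduced_cond (hsign_of_continuation h hhol) hGS hhol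

end Summit.Langlands.Langlands.Theorems.HostInducedRep.OneTransparentPane
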